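import Summits.BirchSwinnertonDyer.Rank1Residual.P2.CongruentNumberPairsAtTwoThreeFiveFamily
import HarnessLib

/-!
# Sub-lane «bsd-p2»: the TWO-PRIME FAMILY `p₃·q₅` RE-KEYED to Tian–Yuan–Zhang Thm 1.2 AS PRINTED
# (ERRATUM F-Σ2, ruling T-81 / T-84: the split "`Σ₁ = g(pq)` odd or `Σ₂' = g(p)g(q) + g(pq)` odd")

HONEST FRAMING (sub-lane «bsd-p2», run/shared/lean/b2b/bsd-rank1-residual/p2/, verbatim in every
file): the target of record is the FULL Birch–Swinnerton-Dyer formula for EVERY analytic-rank `≤ 1`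
`E/ℚ` at ALL primes INCLUDING `2`; the odd-prime class ledger is referee A's; the `2`-part is OPEN
(cells O1 = X5 ∖ CM and O12 = the CM corner) and under census by «bsd-p2». Census / instrument
output at `2` = EVIDENCE / conjecture items with held-out validation, NEVER a Literature fact;
certificates close PAIRS (one isogeny class, `p = 2`), never classes. This file asserts NO
arithmetic fact. WHY THIS FILE: `P2/CongruentNumberPairsAtTwoThreeFiveFamily.lean` (p326971) fed the
GEN-1 fact `thm12_parity_of_scriptL` through its SECOND genus sum, whose typed form `genusSum₂` is
MIS-STATED (it omits the `ℓ = 0` term `{n}`; ERRATUM F-Σ2 in `TianYuanZhang2017/GenusPeriodsParity.lean`,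
lit-1's corrected fact `thm12_parity_of_scriptL'` with `genusSum₂' = genusSum₂ + g(n)`). For primes
`p ≡ 3`, `q ≡ 5 (mod 8)` the printed hypothesis "`Σ₁` odd or `Σ₂'` odd" still holds UNIFORMLY, by a
split on the parity of `g(pq)`: `Σ₁(pq) = g(pq)` (only `{pq}` has at most one factor `≢ 1 (mod 8)`) and
`Σ₂'(pq) = g(p)g(q) + g(pq)` with `g(p)g(q)` odd (p326971) — so `Σ₁` is odd when `g(pq)` is, and `Σ₂'`
is odd otherwise. The family theorem is then VERBATIM the landed one with `h12 : thm12_parity_of_scriptL'`: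
`∀ p q, p ≡ 3 → q ≡ 5 (mod 8) → BSD(E_{pq}, 2)` modulo {TYZ Thm 1.2 (as printed), Rédei–Reichardt, Monsky
1990 Cor 5.15 (2)}, nothing per-curve displayed (a separate file because the append would exceed the
400-line limit of the original). Nothing booked; no mark moved. Unit `b2b-bsdres-p2-typer` GEN 4; NEW file.

References: [TianYuanZhang2017] Thm 1.2; proof of Prop 3.4 (the `ℓ = 0` term); [LiMa2008] Thm 0.4;
[Monsky1990MockHeegner] Cor 5.15 (2); [FaulknerJames2007] Thm 1.2 (2); [Miller2011LMS] Def 1.1;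
HOME/p2/LEAD-OKS.md T-81, T-83, T-84.
-/

noncomputable section

open scoped Classical

open Matrix Finset WeierstrassCurve NumberField Literature.NumberTheory.EllipticCurves
  Literature.NumberTheory.EllipticCurves.Rank1Residual
  Literature.NumberTheory.EllipticCurves.Rank1Residual.Typed
  Literature.NumberTheory.EllipticCurves.Monsky1990
  Literature.NumberTheory.EllipticCurves.HeathBrown1994
  Literature.NumberTheory.EllipticCurves.TianYuanZhang2017
  Literature.NumberTheory.EllipticCurves.FaulknerJames2007
  Literature.NumberTheory.QuadraticFields.RedeiReichardt

set_option autoImplicit false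

namespace Summit.BirchSwinnertonDyer.Rank1Residual.P2

/-! ## §1 `Σ₁(pq) = g(pq)` and the split -/

/-- **`Σ₁(pq; g) = g(pq)`** for primes `p ≡ 3`, `q ≡ 5 (mod 8)`: a decomposition of `pq` with at most one
factor `≢ 1 (mod 8)` cannot contain both `p` and `q`, hence contains `pq`, hence is `{pq}`.
[cite: TianYuanZhang2017, Thm. 1.2 (Σ₁)] -/
theorem genusSum₁_three_five {p q : ℕ} (hp : p.Prime) (hq : q.Prime) (hp3 : p % 8 = 3)
    (hq5 : q % 8 = 5) (g : ℕ → ℕ) : genusSum₁ (p * q) g = g (p * q) := by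
  have hne : p ≠ q := fun h => by omega
  have hn1 : 1 < p * q := one_lt_mul'' hp.one_lt hq.one_lt
  have key : (decompositions (p * q)).filter (fun D => (D.filter fun d => d % 8 ≠ 1).card ≤ 1) =
      {{p * q}} := by
    apply Finset.eq_singleton_iff_unique_mem.mpr
    constructor
    · rw [Finset.mem_filter]
      refine ⟨singleton_mem_decompositions hn1, ?_⟩
      calc (({p * q} : Finset ℕ).filter fun d => d % 8 ≠ 1).card ≤ ({p * q} : Finset ℕ).card :=
            Finset.card_filter_le _ _
        _ = 1 := Finset.card_singleton _
    · intro D hDF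
      rw [Finset.mem_filter] at hDF
      obtain ⟨hD, hcard⟩ := hDF
      have hD' := hD
      simp only [decompositions, Finset.mem_filter, Finset.mem_powerset] at hD'
      obtain ⟨hsub, hgt, hcopr, hprodD⟩ := hD'
      have hmem : ∀ d ∈ D, d = p ∨ d = q ∨ d = p * q := fun d hd =>
        eq_of_dvd_prime_mul hp hq (Nat.dvd_of_mem_divisors (hsub hd)) (hgt d hd)
      by_cases hmul : p * q ∈ D
      · -- every other element would be coprime to `pq`
        apply Finset.eq_singleton_iff_unique_mem.mpr ⟨hmul, fun d hd => ?_⟩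
        by_contra hdn
        have hc : Nat.Coprime (p * q) d := hcopr hmul hd (Ne.symm hdn)
        rcases hmem d hd with rfl | rfl | h
        · exact (Nat.coprime_primes hp hp).mp (Nat.Coprime.coprime_mul_right hc) rfl
        · exact (Nat.coprime_primes hq hq).mp (Nat.Coprime.coprime_mul_left hc) rfl
        · exact hdn h
      · exfalso
        by_cases hpD : p ∈ D
        · by_cases hqD : q ∈ D
          · -- two factors `≢ 1 (mod 8)`
            have hsub2 : ({p, q} : Finset ℕ) ⊆ D.filter fun d => d % 8 ≠ 1 := by
              intro d hd
              simp only [Finset.mem_insert, Finset.mem_singleton] at hd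
              rw [Finset.mem_filter]
              rcases hd with rfl | rfl
              · exact ⟨hpD, by omega⟩
              · exact ⟨hqD, by omega⟩
            have h2 := Finset.card_le_card hsub2
            rw [Finset.card_pair hne] at h2
            omega
          · -- `D ⊆ {p}`: the product `pq` would divide `p`
            have hDp : D ⊆ {p} := fun d hd => by
              rcases hmem d hd with rfl | rfl | rfl
              · simp
              · exact absurd hd hqD
              · exact absurd hd hmul
            have hdvd : p * q ∣ p := by
              rw [← hprodD, ← Finset.prod_singleton (fun d => d) p]
              exact Finset.prod_dvd_prod_of_subset _ _ _ hDp
            have : q ∣ 1 := Nat.dvd_of_mul_dvd_mul_left hp.pos (by simpa using hdvd)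
            exact hq.one_lt.ne' (Nat.dvd_one.mp this)
        · -- `D ⊆ {q}`: the product `pq` would divide `q`
          have hDq : D ⊆ {q} := fun d hd => by
            rcases hmem d hd with rfl | rfl | rfl
            · exact absurd hd hpD
            · simp
            · exact absurd hd hmul
          have hdvd : p * q ∣ q := by
            rw [← hprodD, ← Finset.prod_singleton (fun d => d) q]
            exact Finset.prod_dvd_prod_of_subset _ _ _ hDq
          have : p ∣ 1 := Nat.dvd_of_mul_dvd_mul_right hq.pos (by simpa using hdvd)
          exact hp.one_lt.ne' (Nat.dvd_one.mp this)
  unfold genusSum₁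
  rw [key, Finset.sum_singleton, Finset.prod_singleton]

/-- **The split.** For primes `p ≡ 3`, `q ≡ 5 (mod 8)` and ANY `g`: `Σ₁(pq) = g(pq)` and
`Σ₂'(pq) = g(p)·g(q) + g(pq)`; so if `g(p)·g(q)` is odd then `Σ₁` is odd or `Σ₂'` is odd (according to the
parity of `g(pq)`). [cite: TianYuanZhang2017, Thm. 1.2 (Σ₁, Σ₂); proof of Prop. 3.4 (p0016 L146)] -/
theorem odd_genusSum₁_or_genusSum₂'_three_five {p q : ℕ} (hp : p.Prime) (hq : q.Prime) (hp3 : p % 8 = 3)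
    (hq5 : q % 8 = 5) (g : ℕ → ℕ) (hodd : Odd (g p * g q)) :
    Odd (genusSum₁ (p * q) g) ∨ Odd (genusSum₂' (p * q) g) := by
  have hn1 : 1 < p * q := one_lt_mul'' hp.one_lt hq.one_lt
  have h8 : (p * q) % 8 = 7 := by rw [Nat.mul_mod, hp3, hq5]
  by_cases h : Odd (g (p * q))
  · left; rwa [genusSum₁_three_five hp hq hp3 hq5]
  · right
    rw [genusSum₂'_eq_genusSum₂_add_self hn1 (Or.inr (Or.inr h8)), genusSum₂_three_five hp hq hp3 hq5]
    exact hodd.add_even (Nat.not_odd_iff_even.mp h)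

/-- For primes `p ≡ 3`, `q ≡ 5 (mod 8)` the PRINTED genus condition of TYZ Thm 1.2 holds for
`K_d = GenusField d`: `Σ₁(pq)` odd or `Σ₂'(pq)` odd (`g(p)`, `g(q)` odd: `t = 1` Rédei resp.
`odd_genusClassNumber_genusField_prime_five_mod_eight`).
[cite: TianYuanZhang2017, Thm. 1.2] [cite: LiMa2008, Thm. 0.4] -/
theorem odd_genusSum_genusField_three_five' (hR : redeiReichardt_fourTwoCard_classGroup) {p q : ℕ}
    (hp : p.Prime) (hq : q.Prime) (hp3 : p % 8 = 3) (hq5 : q % 8 = 5) :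
    Odd (genusSum₁ (p * q) fun d => genusClassNumber (GenusField d)) ∨
      Odd (genusSum₂' (p * q) fun d => genusClassNumber (GenusField d)) := by
  exact odd_genusSum₁_or_genusSum₂'_three_five hp hq hp3 hq5 _
    ((odd_genusClassNumber_genusField_prime hR hp (by omega)).mul
      (odd_genusClassNumber_genusField_prime_five_mod_eight hR hq hq5))

/-! ## §2 The family theorem, keyed to Thm 1.2 AS PRINTED -/

/-- **THE TWO-PRIME FAMILY `p₃·q₅`, KEYED TO TYZ Thm 1.2 AS PRINTED** (twin of
`bsdp_two_congruentNumberCurve_three_five` with `h12 : thm12_parity_of_scriptL'`): for primes `p ≡ 3`,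
`q ≡ 5 (mod 8)`, `ord_{s=1} L(E_{pq}, s) = 1` and `BSD(E_{pq}, 2)`, modulo `h12`, `hR`, `h515` — nothing
per-curve displayed (rank one in print: Monsky 1990 Cor 5.15 (2); the `2`-part in no held print; proved
here modulo the displayed facts). [cite: TianYuanZhang2017, Thm. 1.2 and §1 (1.1); proof of Prop. 3.4 (p0016 L146)]
[cite: Monsky1990MockHeegner, Cor. 5.15 (2) (p. 66)] [cite: Miller2011LMS, Def. 1.1 (arXiv:1010.2431 p. 3)] -/
theorem bsdp_two_congruentNumberCurve_three_five' (h12 : thm12_parity_of_scriptL')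
    (hR : redeiReichardt_fourTwoCard_classGroup) (h515 : cor515_rank_eq_one_and_card_selmerGroup_two)
    {p q : ℕ} (hp : p.Prime) (hq : q.Prime) (hp3 : p % 8 = 3) (hq5 : q % 8 = 5) :
    haveI := isElliptic_congruentNumberCurve (Nat.mul_ne_zero hp.ne_zero hq.ne_zero)
    (congruentNumberCurve (p * q)).analyticRank = 1 ∧ BSDp (congruentNumberCurve (p * q)) 2 := by
  have hne : p ≠ q := fun h => by omega
  haveI := isElliptic_congruentNumberCurve (Nat.mul_ne_zero hp.ne_zero hq.ne_zero)
  haveI : Fact (Nat.Prime 2) := ⟨Nat.prime_two⟩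
  have hsq : Squarefree (p * q) := by
    rw [Nat.squarefree_mul ((Nat.coprime_primes hp hq).mpr hne)]
    exact ⟨hp.squarefree, hq.squarefree⟩
  have h8 : (p * q) % 8 = 7 := by rw [Nat.mul_mod, hp3, hq5]
  have hN : IsCor515Family (p * q) := Or.inr (Or.inr (Or.inl ⟨p, q, hp, hq, hp3, Or.inr hq5, rfl⟩))
  have hρ := rhoIndex_eq_one_three_five hp hq hp3 hq5
  obtain ⟨Lz, hLodd, hr1, hderiv⟩ := rankOneDatum_of_index_eq_one' h12 hsq (Or.inr h8) hρ GenusField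
    (isGenusFieldFamily_genusField (p * q)) (odd_genusSum_genusField_three_five' hR hp hq hp3 hq5)
  have hx : deriv (congruentNumberCurve (p * q)).entireLFunction 1 =
      (((2 : ℚ) ^ twoExponent (p * q) * (Lz : ℚ) ^ 2 : ℚ) : ℂ) *
        ((congruentNumberCurve (p * q)).realPeriodRat : ℂ) *
          ((congruentNumberCurve (p * q)).regulator : ℂ) := by
    rw [hderiv]; push_cast; ring
  have hx0 : (2 : ℚ) ^ twoExponent (p * q) * (Lz : ℚ) ^ 2 ≠ 0 := by
    have hL0' : Lz ≠ 0 := fun h => by simp [h] at hLodd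
    have hL0 : (Lz : ℚ) ≠ 0 := by exact_mod_cast hL0'
    exact mul_ne_zero (zpow_ne_zero _ two_ne_zero) (pow_ne_zero _ hL0)
  have hpv : ∀ i, ((![p, q] : Fin 2 → ℕ) i).Prime := fun i => by fin_cases i <;> assumption
  have hov : ∀ i, Odd ((![p, q] : Fin 2 → ℕ) i) := fun i => by
    fin_cases i
    · exact hp.odd_of_ne_two (fun h => by omega)
    · exact hq.odd_of_ne_two (fun h => by omega)
  have hiv : Function.Injective (![p, q] : Fin 2 → ℕ) := by
    intro i j h; fin_cases i <;> fin_cases j <;> simp_all [hne.symm]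
  have hnv : ∏ i, (![p, q] : Fin 2 → ℕ) i = p * q := by simp [Fin.prod_univ_two]
  have he : twoExponent (p * q) = 1 := by
    rw [← hnv, twoExponent_prod_eq _ hpv hov hiv]; norm_num
  obtain ⟨-, hiff⟩ := bsdp_two_congruentNumberCurve_iff_of_cor515 h515 hN
    (torsionOrder_congruentNumberCurve hsq) hx0 hx
  refine ⟨hr1, hiff.mpr ?_⟩
  rw [padicValRat_two_zpow_mul_sq hLodd, he, tamagawaProduct_congruentNumberCurve_prod _ hpv hov hiv hnv,
    padicValNat.prime_pow]
  norm_num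

/-- **`BSD(E_{pq}, 2)` for ALL primes `p ≡ 3`, `q ≡ 5 (mod 8)`, keyed to TYZ Thm 1.2 AS PRINTED** (twin of
`forall_bsdp_two_congruentNumberCurve_three_five`), modulo `h12`, `hR`, `h515`; no per-curve input.
[cite: TianYuanZhang2017, Thm. 1.2 and §1 (1.1)] [cite: Monsky1990MockHeegner, Cor. 5.15 (2) (p. 66)]
[cite: FaulknerJames2007, Thm. 1.2 (2)] [cite: Miller2011LMS, Def. 1.1 (arXiv:1010.2431 p. 3)] -/
theorem forall_bsdp_two_congruentNumberCurve_three_five' (h12 : thm12_parity_of_scriptL')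
    (hR : redeiReichardt_fourTwoCard_classGroup) (h515 : cor515_rank_eq_one_and_card_selmerGroup_two) :
    ∀ p q : ℕ, p.Prime → q.Prime → p % 8 = 3 → q % 8 = 5 → BSDp (congruentNumberCurve (p * q)) 2 :=
  fun _ _ hp hq hp3 hq5 => (bsdp_two_congruentNumberCurve_three_five' h12 hR h515 hp hq hp3 hq5).2

end Summit.BirchSwinnertonDyer.Rank1Residual.P2

end
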